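import Mathlib
import Summits.AnomalousDissipation.AnomalousDissipation.Theorems.TaylorCertificatePair.Negative.ModesFourier
import Summits.AnomalousDissipation.AnomalousDissipation.Theorems.TaylorCertificatesPhantomFloorLawStrain
import Summits.AnomalousDissipation.AnomalousDissipation.Theorems.TaylorCertificatesPhantomFloorLawPairing
import Literature.Analysis.FunctionSpaces.TorusEnstrophyOrthogonality

/-!
# Phantom floor law — support IV: bookkeeping at the dressed states

Support for `Theorems/TaylorCertificatesPhantomFloorLaw.lean` (stmt-AnomalousDissipation-14033). States of `H` with
smooth representatives and the FLOOR inequality unpacked at them; the `±` bookkeeping for `a ± ŵ` complementing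
(parallelogram laws for enstrophy and energy, inertial and linear `±` identities, states with their energy); invisibility of a packet without
modes in the `2D`-ball to band-limited test fields; sums/differences of admissible fields; `νN² ≤ C²` in the Taylor
class; the Euler identity of a standing flow read on a multiplier and the integrated stress defect of its
truncation; small viscosities.
-/

noncomputable section

-- `Summit.<Summit>.<Sub>` repeats `AnomalousDissipation` by the tree's layout (D-0017), as in the sibling files.
set_option linter.dupNamespace false

open MeasureTheory Filter Topology UnitAddTorus
open scoped InnerProductSpace ENNReal

namespace Summit.AnomalousDissipation.AnomalousDissipation.Theorems.PhantomFloor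

open Literature.Analysis.FunctionSpaces Literature.Analysis.FluidPDE
open Summit.AnomalousDissipation.AnomalousDissipation.Theorems.TaylorCertificatePair.Negative

/-! ## States of `H` with smooth representatives -/

/-- The spectral enstrophy of a state with a smooth representative is finite. -/
theorem eGradNormSq_coe_ne_top {u : Torus.energySpace (Fin 3)} {v : (UnitAddTorus (Fin 3)) → (EuclideanSpace ℝ (Fin 3))}
    (hu : ((u : (Lp (EuclideanSpace ℝ (Fin 3)) 2 (volume : Measure (UnitAddTorus (Fin 3))))) : (UnitAddTorus (Fin 3)) → (EuclideanSpace ℝ (Fin 3))) =ᵐ[volume] v) (hv : Torus.IsSmooth v) :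
    Torus.eGradNormSq ((u : (Lp (EuclideanSpace ℝ (Fin 3)) 2 (volume : Measure (UnitAddTorus (Fin 3))))) : (UnitAddTorus (Fin 3)) → (EuclideanSpace ℝ (Fin 3))) ≠ ⊤ := by
  rw [eGradNormSq_congr_ae' hu]
  exact (hv.memSobolev_one_complexify.eGradNormSq_lt_top).ne

/-- **The floor inequality at a state with a smooth representative, unpacked.** If the FLOOR holds at the
state `U ∈ H` of the smooth field `w`, then with `W = Φ₁'(U)`:
`ε₀ ≤ ν‖∇w‖² + [(f, W) + ν (w, ΔW) + ∫ ⟪DW w, w⟫] + 2θ₁((w, f) − ν‖∇w‖²)`, all as integrals of smooth functions. -/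
theorem floor_unpack {ν ε₀ θ₁ : ℝ} {f : (UnitAddTorus (Fin 3)) → (EuclideanSpace ℝ (Fin 3))} {Φ₁ : Torus.CylindricalTest (Fin 3)}
    {U : Torus.energySpace (Fin 3)} {w : (UnitAddTorus (Fin 3)) → (EuclideanSpace ℝ (Fin 3))}
    (hU : ((U : (Lp (EuclideanSpace ℝ (Fin 3)) 2 (volume : Measure (UnitAddTorus (Fin 3))))) : (UnitAddTorus (Fin 3)) → (EuclideanSpace ℝ (Fin 3))) =ᵐ[volume] w) (hw : Torus.IsSmooth w)
    (hfl : ε₀ ≤ ν * (Torus.eGradNormSq ((U : (Lp (EuclideanSpace ℝ (Fin 3)) 2 (volume : Measure (UnitAddTorus (Fin 3))))) : (UnitAddTorus (Fin 3)) → (EuclideanSpace ℝ (Fin 3)))).toReal +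
        Torus.nsGeneratorPairing ν f U (Φ₁.grad U) +
        2 * θ₁ * (Torus.pairing (U : (Lp (EuclideanSpace ℝ (Fin 3)) 2 (volume : Measure (UnitAddTorus (Fin 3))))) f - ν * (Torus.eGradNormSq ((U : (Lp (EuclideanSpace ℝ (Fin 3)) 2 (volume : Measure (UnitAddTorus (Fin 3))))) : (UnitAddTorus (Fin 3)) → (EuclideanSpace ℝ (Fin 3)))).toReal)) :
    ε₀ ≤ ν * Torus.gradNormSq w +
      ((∫ x, ⟪f x, Φ₁.grad U x⟫_ℝ) + ν * (∫ x, ⟪w x, Torus.laplacian (Φ₁.grad U) x⟫_ℝ) +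
        ∫ x, ⟪Torus.fderiv (Φ₁.grad U) x (w x), w x⟫_ℝ) +
      2 * θ₁ * ((∫ x, ⟪w x, f x⟫_ℝ) - ν * Torus.gradNormSq w) := by
  rw [nsGeneratorPairing_of_ae hU, pairing_of_ae hU, eGradNormSq_congr_ae' hU,
    ← Torus.gradNormSq_eq_toReal_eGradNormSq_holds hw] at hfl
  exact hfl

/-! ## The `±` bookkeeping for smooth fields -/

section PlusMinus

variable {a w : (UnitAddTorus (Fin 3)) → (EuclideanSpace ℝ (Fin 3))} (ha : Torus.IsSmooth a) (hw : Torus.IsSmooth w)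

include ha hw

/-- Parallelogram law for the enstrophy: `‖∇(a+w)‖² + ‖∇(a−w)‖² = 2‖∇a‖² + 2‖∇w‖²`. -/
theorem gradNormSq_add_add_sub :
    Torus.gradNormSq (a + w) + Torus.gradNormSq (a - w) = 2 * Torus.gradNormSq a + 2 * Torus.gradNormSq w := by
  have ha1 : Torus.IsContDiff 1 a := ha.isContDiff (by simp)
  have hw1 : Torus.IsContDiff 1 w := hw.isContDiff (by simp)
  have hadd : ∀ i x, Torus.partialDeriv i (a + w) x = Torus.partialDeriv i a x + Torus.partialDeriv i w x := by
    intro i x; rw [Torus.partialDeriv_add ha1 hw1 i]; rfl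
  have hsub : ∀ i x, Torus.partialDeriv i (a - w) x = Torus.partialDeriv i a x - Torus.partialDeriv i w x := by
    intro i x
    have e : a - w = a + (-1 : ℝ) • w := by funext y; simp [sub_eq_add_neg]
    rw [e, Torus.partialDeriv_add ha1 (hw1.smul (-1)) i, Torus.partialDeriv_const_smul hw1 (-1) i]
    simp [sub_eq_add_neg]
  unfold Torus.gradNormSq
  have hi : ∀ (u : (UnitAddTorus (Fin 3)) → (EuclideanSpace ℝ (Fin 3))), Torus.IsSmooth u → Integrable (fun x => ∑ i, ‖Torus.partialDeriv i u x‖ ^ 2) volume :=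
    fun u hu => (Torus.isSmooth_sum_norm_sq_partialDeriv hu).integrable
  rw [← integral_add (hi _ (ha.add hw)) (hi _ (ha.sub hw)), ← integral_const_mul, ← integral_const_mul,
    ← integral_add ((hi _ ha).const_mul _) ((hi _ hw).const_mul _)]
  refine integral_congr_ae (ae_of_all _ fun x => ?_)
  simp only [hadd, hsub, Finset.mul_sum, ← Finset.sum_add_distrib]
  refine Finset.sum_congr rfl fun i _ => ?_
  have := parallelogram_law_with_norm ℝ (Torus.partialDeriv i a x) (Torus.partialDeriv i w x)
  nlinarith [this]

/-- Energies: `∫‖a − w‖² ≤ 2∫‖a‖² + 2∫‖w‖²`. -/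
theorem integral_norm_sq_sub_le :
    ∫ x, ‖(a - w) x‖ ^ 2 ≤ 2 * (∫ x, ‖a x‖ ^ 2) + 2 * ∫ x, ‖w x‖ ^ 2 := by
  rw [← integral_const_mul, ← integral_const_mul,
    ← integral_add (ha.norm_sq.integrable.const_mul _) (hw.norm_sq.integrable.const_mul _)]
  refine integral_mono (ha.sub hw).norm_sq.integrable
    ((ha.norm_sq.integrable.const_mul _).add (hw.norm_sq.integrable.const_mul _)) fun x => ?_
  have := parallelogram_law_with_norm ℝ (a x) (w x)
  simp only [Pi.sub_apply]
  nlinarith [this, sq_nonneg ‖a x + w x‖, mul_self_nonneg ‖a x + w x‖]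

end PlusMinus

/-! ## Packets are invisible to band-limited fields -/

/-- **Orthogonality of a packet to the resolved scales**: if `P_{L} w = 0` and `g` is band-limited at
`N ≤ L`, then `(w, g) = 0`. -/
theorem integral_inner_eq_zero_of_truncate_eq_zero {w g : (UnitAddTorus (Fin 3)) → (EuclideanSpace ℝ (Fin 3))} (hw : Torus.IsSmooth w) (hg : Torus.IsSmooth g)
    {L N : ℕ} (hNL : N ≤ L) (hw0 : Torus.fourierTruncate L w = 0)
    (hband : ∀ κ, (N : ℝ) ^ 2 < Torus.freqNormSq κ → mFourierCoeff (EuclideanSpace.complexify ∘ g) κ = 0) :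
    ∫ x, ⟪w x, g x⟫_ℝ = 0 := by
  rw [Torus.integral_inner_eq_sum_freqBall (hw.memLp 2) (hg.memLp 2) hband]
  refine Finset.sum_eq_zero fun k hk => ?_
  have hk' : k ∈ Torus.freqBall L := Torus.freqBall_mono hNL hk
  have h1 := Torus.mFourierCoeff_fourierTruncate hw.integrable L k
  rw [if_pos hk', hw0] at h1
  have h0 : mFourierCoeff (EuclideanSpace.complexify ∘ (0 : (UnitAddTorus (Fin 3)) → (EuclideanSpace ℝ (Fin 3)))) k = 0 := by
    have : (EuclideanSpace.complexify ∘ (0 : (UnitAddTorus (Fin 3)) → (EuclideanSpace ℝ (Fin 3)))) = fun _ => (0 : EuclideanSpace ℂ (Fin 3)) := by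
      funext x; simp
    rw [this]; simp [mFourierCoeff]
  rw [← h1, h0, inner_zero_left, Complex.zero_re]

/-! ## The resolution bound `ν N² ≤ C²` in the Taylor class -/

/-- In the Taylor class `N ≤ C ν^{-1/2}` the viscous price of resolved modes is `ν N² ≤ C²`. -/
theorem nu_mul_sq_le_sq {ν C : ℝ} {N : ℕ} (hν : 0 < ν) (hN : (N : ℝ) ≤ C * ν ^ (-(1 / 2 : ℝ))) :
    ν * (N : ℝ) ^ 2 ≤ C ^ 2 := by
  have hp : 0 < ν ^ (-(1 / 2 : ℝ)) := Real.rpow_pos_of_pos hν _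
  have hN0 : (0 : ℝ) ≤ N := Nat.cast_nonneg N
  have hC : 0 ≤ C := by nlinarith
  have h1 : (N : ℝ) ^ 2 ≤ (C * ν ^ (-(1 / 2 : ℝ))) ^ 2 := pow_le_pow_left₀ hN0 hN 2
  have h2 : (ν ^ (-(1 / 2 : ℝ))) ^ 2 = ν⁻¹ := by
    rw [← Real.rpow_natCast, ← Real.rpow_mul hν.le]
    norm_num
    exact Real.rpow_neg_one ν
  rw [mul_pow, h2] at h1
  have := mul_le_mul_of_nonneg_left h1 hν.le
  rwa [← mul_assoc, mul_comm ν (C ^ 2), mul_assoc, mul_inv_cancel₀ hν.ne', mul_one] at this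

/-! ## Sums and differences of admissible fields -/

/-- Differences of smooth divergence-free fields are divergence free. -/
theorem isDivFree_sub' {a w : (UnitAddTorus (Fin 3)) → (EuclideanSpace ℝ (Fin 3))} (ha : Torus.IsSmooth a) (hw : Torus.IsSmooth w)
    (hda : Torus.IsDivFree a) (hdw : Torus.IsDivFree w) : Torus.IsDivFree (a - w) := by
  have h := Torus.IsDivFree.sum_smul Finset.univ (![(1 : ℝ), -1]) (g := ![a, w])
    (by intro i; fin_cases i <;> simpa) (by intro i; fin_cases i <;> simpa)
  have e : (fun y => ∑ i ∈ Finset.univ, (![(1 : ℝ), -1]) i • (![a, w] : Fin 2 → (UnitAddTorus (Fin 3)) → (EuclideanSpace ℝ (Fin 3))) i y) = a - w := by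
    funext y; simp [Fin.sum_univ_two, sub_eq_add_neg]
  rwa [e] at h

/-! ## The standing flow: Euler identity and the stress defect -/

/-- **The Euler identity read on the multiplier**: if `∫ (⟪v, (v·∇)W⟫ + ⟪f, W⟫) = 0` for the `L²` field `v`,
then the inertial pairing of `v` against `W` is `−(f, W)`. -/
theorem inertial_eq_neg_of_euler {v f W : (UnitAddTorus (Fin 3)) → (EuclideanSpace ℝ (Fin 3))} (hv2 : MemLp v 2 volume) (hf : Torus.IsSmooth f)
    (hW : Torus.IsSmooth W) (hE : ∫ x, (⟪v x, Torus.convect v W x⟫_ℝ + ⟪f x, W x⟫_ℝ) = 0) :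
    ∫ x, ⟪Torus.fderiv W x (v x), v x⟫_ℝ = -∫ x, ⟪f x, W x⟫_ℝ := by
  have h1 : Integrable (fun x => ⟪v x, Torus.convect v W x⟫_ℝ) volume := by
    refine (integrable_inertial hv2 hW).congr (ae_of_all _ fun x => ?_)
    exact real_inner_comm _ _
  have h2 : Integrable (fun x => ⟪f x, W x⟫_ℝ) volume := (hf.inner hW).integrable
  rw [integral_add h1 h2] at hE
  have e : ∫ x, ⟪Torus.fderiv W x (v x), v x⟫_ℝ = ∫ x, ⟪v x, Torus.convect v W x⟫_ℝ :=
    integral_congr_ae (ae_of_all _ fun x => real_inner_comm _ _)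
  rw [e]
  linarith

/-- **The stress defect of the truncation, integrated**: for smooth `a`, `v ∈ L²` and a smooth multiplier `W`
with strain bound `|⟪DW(x) y, y⟫| ≤ s‖y‖²`,
`I(a, W) − I(v, W) ≤ s (τ ∫‖v‖² + τ⁻¹ ∫‖a − v‖² + ∫‖a − v‖²)` for every `τ > 0`. -/
theorem inertial_defect_le {a v W : (UnitAddTorus (Fin 3)) → (EuclideanSpace ℝ (Fin 3))} (ha : Torus.IsSmooth a) (hv2 : MemLp v 2 volume)
    (hW : Torus.IsSmooth W) {s τ : ℝ} (hq : ∀ (x : (UnitAddTorus (Fin 3))) (y : (EuclideanSpace ℝ (Fin 3))), |⟪Torus.fderiv W x y, y⟫_ℝ| ≤ s * ‖y‖ ^ 2)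
    (hτ : 0 < τ) :
    (∫ x, ⟪Torus.fderiv W x (a x), a x⟫_ℝ) - ∫ x, ⟪Torus.fderiv W x (v x), v x⟫_ℝ ≤
      s * (τ * (∫ x, ‖v x‖ ^ 2) + τ⁻¹ * (∫ x, ‖a x - v x‖ ^ 2) + ∫ x, ‖a x - v x‖ ^ 2) := by
  have hav : MemLp (fun x => a x - v x) 2 volume := (ha.memLp 2).sub hv2
  have hIa : Integrable (fun x => ⟪Torus.fderiv W x (a x), a x⟫_ℝ) volume := integrable_inertial (ha.memLp 2) hW
  have hIv : Integrable (fun x => ⟪Torus.fderiv W x (v x), v x⟫_ℝ) volume := integrable_inertial hv2 hW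
  have hv' : Integrable (fun x => ‖v x‖ ^ 2) volume := hv2.integrable_norm_pow two_ne_zero
  have hh' : Integrable (fun x => ‖a x - v x‖ ^ 2) volume := hav.integrable_norm_pow two_ne_zero
  have hR : Integrable (fun x => s * (τ * ‖v x‖ ^ 2 + τ⁻¹ * ‖a x - v x‖ ^ 2 + ‖a x - v x‖ ^ 2)) volume :=
    (((hv'.const_mul τ).add (hh'.const_mul τ⁻¹)).add hh').const_mul s
  rw [← integral_sub hIa hIv]
  have hmono := integral_mono (hIa.sub hIv) hR fun x => quad_defect_le (Torus.fderiv W x) (hq x) (a x) (v x) hτ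
  refine hmono.trans (le_of_eq ?_)
  rw [integral_const_mul]
  congr 1
  rw [integral_add (f := fun x => τ * ‖v x‖ ^ 2 + τ⁻¹ * ‖a x - v x‖ ^ 2) (g := fun x => ‖a x - v x‖ ^ 2)
      ((hv'.const_mul τ).add (hh'.const_mul τ⁻¹)) hh',
    integral_add (f := fun x => τ * ‖v x‖ ^ 2) (g := fun x => τ⁻¹ * ‖a x - v x‖ ^ 2)
      (hv'.const_mul τ) (hh'.const_mul τ⁻¹), integral_const_mul, integral_const_mul]

/-! ## Small viscosities -/

/-- `ν K ≤ c` for all small `ν > 0` (`c > 0`). -/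
theorem eventually_mul_le (K : ℝ) {c : ℝ} (hc : 0 < c) : ∀ᶠ ν in 𝓝[>] (0 : ℝ), ν * K ≤ c := by
  have ht : Tendsto (fun ν : ℝ => ν * K) (𝓝 0) (𝓝 0) := by
    simpa using (tendsto_id (x := 𝓝 (0 : ℝ))).mul_const K
  exact (ht.eventually (Iic_mem_nhds hc)).filter_mono nhdsWithin_le_nhds

/-- A viscosity below `ν₀` and `1` satisfying four smallness conditions `ν Kᵢ ≤ cᵢ`. -/
theorem exists_small_nu {ν₀ : ℝ} (hν₀ : 0 < ν₀) (K₁ K₂ K₃ K₄ : ℝ) {c₁ c₂ c₃ c₄ : ℝ}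
    (h₁ : 0 < c₁) (h₂ : 0 < c₂) (h₃ : 0 < c₃) (h₄ : 0 < c₄) :
    ∃ ν : ℝ, 0 < ν ∧ ν < ν₀ ∧ ν ≤ 1 ∧ ν * K₁ ≤ c₁ ∧ ν * K₂ ≤ c₂ ∧ ν * K₃ ≤ c₃ ∧ ν * K₄ ≤ c₄ := by
  have e0 : ∀ᶠ ν in 𝓝[>] (0 : ℝ), 0 < ν := eventually_mem_nhdsWithin
  have e1 : ∀ᶠ ν in 𝓝[>] (0 : ℝ), ν < ν₀ := (eventually_lt_nhds hν₀).filter_mono nhdsWithin_le_nhds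
  have e2 : ∀ᶠ ν in 𝓝[>] (0 : ℝ), ν ≤ 1 := (eventually_le_nhds one_pos).filter_mono nhdsWithin_le_nhds
  obtain ⟨ν, hν⟩ := (e0.and (e1.and (e2.and ((eventually_mul_le K₁ h₁).and ((eventually_mul_le K₂ h₂).and
    ((eventually_mul_le K₃ h₃).and (eventually_mul_le K₄ h₄))))))).exists
  exact ⟨ν, hν.1, hν.2.1, hν.2.2.1, hν.2.2.2.1, hν.2.2.2.2.1, hν.2.2.2.2.2.1, hν.2.2.2.2.2.2⟩

/-! ## Complements: states with their energy, and the `±` symmetrisation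

These replace the corresponding tools of `KolmogorovFloor/Negative/CheapBaseTools.lean`, whose import chain
(`FloorCertificate/Negative/WeakDuality.lean`) refers to route declarations dropped at rev 13. -/

/-- A smooth solenoidal mean-zero field is (a.e.) the representative of a state of `H`, whose squared norm is
the energy of the field. -/
theorem exists_state_of_smooth_energy {v : (UnitAddTorus (Fin 3)) → (EuclideanSpace ℝ (Fin 3))} (hv : Torus.IsSmooth v) (hdiv : Torus.IsDivFree v)
    (hmean : Torus.HasZeroMean v) :
    ∃ u : Torus.energySpace (Fin 3), ((u : (Lp (EuclideanSpace ℝ (Fin 3)) 2 (volume : Measure (UnitAddTorus (Fin 3))))) : (UnitAddTorus (Fin 3)) → (EuclideanSpace ℝ (Fin 3))) =ᵐ[volume] v ∧ ‖u‖ ^ 2 = ∫ x, ‖v x‖ ^ 2 := by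
  set u : Torus.energySpace (Fin 3) := ⟨(hv.memLp 2).toLp v,
    Torus.smoothSolenoidal_subset_energySpace ⟨v, hv, hdiv, hmean, MemLp.coeFn_toLp _⟩⟩ with hu
  have hae : ((u : (Lp (EuclideanSpace ℝ (Fin 3)) 2 (volume : Measure (UnitAddTorus (Fin 3))))) : (UnitAddTorus (Fin 3)) → (EuclideanSpace ℝ (Fin 3))) =ᵐ[volume] v := (hv.memLp 2).coeFn_toLp
  exact ⟨u, hae, norm_sq_of_ae hae⟩

section PlusMinus2

variable {a w : (UnitAddTorus (Fin 3)) → (EuclideanSpace ℝ (Fin 3))} (ha : Torus.IsSmooth a) (hw : Torus.IsSmooth w)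

include ha hw

/-- The `±` symmetrisation of the inertial quadratic form, as a vanishing combination:
`I(a+w, W) + I(a−w, W) − 2 I(a, W) − 2 I(w, W) = 0`. -/
theorem inertial_pm_sub_eq_zero {W : (UnitAddTorus (Fin 3)) → (EuclideanSpace ℝ (Fin 3))} (hW : Torus.IsSmooth W) :
    (∫ x, ⟪Torus.fderiv W x ((a + w) x), (a + w) x⟫_ℝ) + (∫ x, ⟪Torus.fderiv W x ((a - w) x), (a - w) x⟫_ℝ) -
      2 * (∫ x, ⟪Torus.fderiv W x (a x), a x⟫_ℝ) - 2 * (∫ x, ⟪Torus.fderiv W x (w x), w x⟫_ℝ) = 0 := by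
  have hi : ∀ (u : (UnitAddTorus (Fin 3)) → (EuclideanSpace ℝ (Fin 3))), Torus.IsSmooth u →
      Integrable (fun x => ⟪Torus.fderiv W x (u x), u x⟫_ℝ) volume :=
    fun u hu => ((hu.convect hW).inner hu).integrable
  have h : (∫ x, ⟪Torus.fderiv W x ((a + w) x), (a + w) x⟫_ℝ) + (∫ x, ⟪Torus.fderiv W x ((a - w) x), (a - w) x⟫_ℝ) =
      2 * (∫ x, ⟪Torus.fderiv W x (a x), a x⟫_ℝ) + 2 * ∫ x, ⟪Torus.fderiv W x (w x), w x⟫_ℝ := by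
    rw [← integral_add (hi _ (ha.add hw)) (hi _ (ha.sub hw)), ← integral_const_mul, ← integral_const_mul,
      ← integral_add ((hi _ ha).const_mul _) ((hi _ hw).const_mul _)]
    refine integral_congr_ae (ae_of_all _ fun x => ?_)
    simp only [Pi.add_apply, Pi.sub_apply, map_add, map_sub, inner_add_left, inner_add_right, inner_sub_left,
      inner_sub_right]
    ring
  rw [h]
  ring

/-- Linear pairings against a continuous field: `(a+w, g) + (a−w, g) = 2 (a, g)`. -/
theorem pairing_add_add_sub {g : (UnitAddTorus (Fin 3)) → (EuclideanSpace ℝ (Fin 3))} (hg : Continuous g) :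
    (∫ x, ⟪(a + w) x, g x⟫_ℝ) + (∫ x, ⟪(a - w) x, g x⟫_ℝ) = 2 * ∫ x, ⟪a x, g x⟫_ℝ := by
  have hi : ∀ (u : (UnitAddTorus (Fin 3)) → (EuclideanSpace ℝ (Fin 3))), Torus.IsSmooth u → Integrable (fun x => ⟪u x, g x⟫_ℝ) volume :=
    fun u hu => (hu.continuous.inner hg).integrable_unitAddTorus
  rw [← integral_add (hi _ (ha.add hw)) (hi _ (ha.sub hw)), ← integral_const_mul]
  refine integral_congr_ae (ae_of_all _ fun x => ?_)
  simp only [Pi.add_apply, Pi.sub_apply, inner_add_left, inner_sub_left]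
  ring

/-- Parallelogram law for the energies: `∫‖a+w‖² + ∫‖a−w‖² = 2∫‖a‖² + 2∫‖w‖²`. -/
theorem integral_norm_sq_add_add_sub :
    (∫ x, ‖(a + w) x‖ ^ 2) + (∫ x, ‖(a - w) x‖ ^ 2) = 2 * (∫ x, ‖a x‖ ^ 2) + 2 * ∫ x, ‖w x‖ ^ 2 := by
  rw [← integral_add (ha.add hw).norm_sq.integrable (ha.sub hw).norm_sq.integrable, ← integral_const_mul,
    ← integral_const_mul, ← integral_add (ha.norm_sq.integrable.const_mul _) (hw.norm_sq.integrable.const_mul _)]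
  refine integral_congr_ae (ae_of_all _ fun x => ?_)
  have := parallelogram_law_with_norm ℝ (a x) (w x)
  simp only [Pi.add_apply, Pi.sub_apply]
  nlinarith [this]

end PlusMinus2

end Summit.AnomalousDissipation.AnomalousDissipation.Theorems.PhantomFloor
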